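/-
Copyright (c) 2026. All rights reserved.
Released under Apache 2.0 license as described in the file LICENSE.
-/
import Mathlib
import HarnessLib
import Literature.Topology.FourManifolds.CircleLoopClasses

/-!
# Concatenation of annuli: additivity of inserted extension classes

Topic `Literature/Topology/FourManifolds`. Module G2 of the proof of
`Literature.Topology.FourManifolds.exists_middleLevel_isStabilization_of_isHCobordism` (Kirby 1989,
Ch. X pp. 55–56, the odd case), continuing `CircleLoopClasses.lean`: the bookkeeping that reduces the
class inserted by a concatenated loop of circles to the classes of its pieces.

* §1 `eClass_insertDisc_add_eClass_path` — along an annulus `R` from the circle `α` to the circle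
  `β`, `e(Fα, insert R W) + e(Fβ, W)` does not depend on the disc `W` bounding `β` (sliding).
* §2 concatenation `R ⋆ S` and reversal `R̄` of annuli; `eClass_insertDisc_concatA_revA`:
  `e(F, insert (R ⋆ R̄) X) = e(F, X)` (the loops "along `R` up to time `s` and back" are a
  homotopy to the constant annulus).
* §3–§4 three-layer discs and `eClass_insertDisc_concatA`:
  `e(F, insert (R ⋆ S) W) = e(F, insert R (insert S W))` (a family of three-layer discs with moving
  radii, all with the same boundary).
* §5 `eClass_insertDisc_insertDisc_revA`, `eClass_insertDisc_revA_add`: going along `R` and back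
  does not change the class; the class transported along `R̄` equals that along `R`.

Everything is proved; no named facts are introduced.

## References

* R. C. Kirby, *The topology of 4-manifolds*, LNM 1374 (1989), Ch. X, pp. 55–56. [Kirby1989]
-/

noncomputable section

open Set Function Metric Topology Bundle
open scoped Topology Manifold ContDiff unitInterval

namespace Literature.Topology.FourManifolds

namespace StableFrames

/-- Local notation: `𝔼 n` is the model Euclidean space `EuclideanSpace ℝ (Fin n)`. -/
local notation "𝔼 " n:arg => EuclideanSpace ℝ (Fin n)

/-- Local notation: the unit circle. -/
local notation "𝕊¹" => (sphere (0 : EuclideanSpace ℝ (Fin (1 + 1))) 1)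

/-- Local notation: the closed unit disc in the plane. -/
local notation "𝔻²" => UnitDisc2

/-- Local notation: the unit `2`-sphere. -/
local notation "𝕊²" => (sphere (0 : EuclideanSpace ℝ (Fin (2 + 1))) 1)

variable {m : ℕ} {M : Type*} [TopologicalSpace M] [ChartedSpace (𝔼 m) M] [IsManifold (𝓡 m) 1 M]

/-! ### 1. Additivity along a path of circles -/

/-- **The class transported along a path of circles does not depend on the disc.**  For an
annulus `R` from the circle `α` (frame `Fα`) to the circle `β` (frame `Fβ`) and discs `W`, `W'`
bounding `β`: `e(Fα, insert R W) + e(Fβ, W) = e(Fα, insert R W') + e(Fβ, W')`. [folklore] -/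
theorem eClass_insertDisc_add_eClass_path (hm : 2 ≤ m) {α β : 𝕊¹ → M} (R : C(ℝ × 𝕊¹, M))
    (hR0 : ∀ u, R (0, u) = α u) (hR1 : ∀ u, R (1, u) = β u) (W W' : C(𝔻², M)) (hW : ∀ u, W (bd u) = β u)
    (hW' : ∀ u, W' (bd u) = β u) {Fα Fβ : 𝕊¹ → Fr m} (hFα : IsStableFrameFieldOn α Fα univ)
    (hFβ : IsStableFrameFieldOn β Fβ univ) :
    eClass (insertDisc R W fun u => (hR1 u).trans (hW u).symm) Fα
        (hFα.congr_map fun u _ => by change insertDisc R W _ (bd u) = α u; rw [insertDisc_bd, hR0]) +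
      eClass W Fβ (hFβ.congr_map fun u _ => hW u) =
    eClass (insertDisc R W' fun u => (hR1 u).trans (hW' u).symm) Fα
        (hFα.congr_map fun u _ => by change insertDisc R W' _ (bd u) = α u; rw [insertDisc_bd, hR0]) +
      eClass W' Fβ (hFβ.congr_map fun u _ => hW' u) := by
  have hF₁ : IsStableFrameFieldOn (insertDisc R W (fun u => (hR1 u).trans (hW u).symm) ∘ bd) Fα univ :=
    hFα.congr_map fun u _ => by change insertDisc R W _ (bd u) = α u; rw [insertDisc_bd, hR0]
  have hF₂ : IsStableFrameFieldOn (W ∘ bd) Fβ univ := hFβ.congr_map fun u _ => hW u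
  have k1 := framed_glue_iff hm (insertDisc R W fun u => (hR1 u).trans (hW u).symm)
    (insertDisc R W' fun u => (hR1 u).trans (hW' u).symm) (fun u => by rw [insertDisc_bd, insertDisc_bd]) hF₁
  have k2 := framed_glue_iff hm W W' (fun u => (hW u).trans (hW' u).symm) hF₂
  have k3 := framed_glue_insertDisc_iff (m := m) R W W' (fun u => (hR1 u).trans (hW u).symm) (fun u => (hR1 u).trans (hW' u).symm)
  have key := (k1.symm.trans k3).trans k2
  have : ∀ a b c d : ZMod 2, (a = b ↔ c = d) → a + c = b + d := by decide
  exact this _ _ _ _ key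

/-! ### 2. Concatenation and reversal of annuli -/

/-- **Concatenation of annuli in time** (`R` on `[0, 1/2]`, `S` on `[1/2, 1]`, double speed).
[folklore] -/
def concatA (R S : C(ℝ × 𝕊¹, M)) (h : ∀ u, R (1, u) = S (0, u)) : C(ℝ × 𝕊¹, M) :=
  ⟨fun q => if q.1 ≤ 2⁻¹ then R (2 * q.1, q.2) else S (2 * q.1 - 1, q.2), by
    refine Continuous.if_le ?_ ?_ continuous_fst continuous_const fun q hq => ?_
    · exact R.continuous.comp ((continuous_const.mul continuous_fst).prodMk continuous_snd)
    · exact S.continuous.comp (((continuous_const.mul continuous_fst).sub continuous_const).prodMk continuous_snd)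
    · rw [hq, show (2 : ℝ) * 2⁻¹ = 1 by norm_num, sub_self]; exact h q.2⟩

omit [ChartedSpace (𝔼 m) M] [IsManifold (𝓡 m) 1 M] in
/-- The concatenation starts where `R` starts. [folklore] -/
theorem concatA_zero (R S : C(ℝ × 𝕊¹, M)) (h : ∀ u, R (1, u) = S (0, u)) (u : 𝕊¹) : concatA R S h (0, u) = R (0, u) := by
  change (if (0 : ℝ) ≤ 2⁻¹ then R (2 * 0, u) else S (2 * 0 - 1, u)) = R (0, u)
  rw [if_pos (by norm_num), mul_zero]

omit [ChartedSpace (𝔼 m) M] [IsManifold (𝓡 m) 1 M] in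
/-- The concatenation ends where `S` ends. [folklore] -/
theorem concatA_one (R S : C(ℝ × 𝕊¹, M)) (h : ∀ u, R (1, u) = S (0, u)) (u : 𝕊¹) : concatA R S h (1, u) = S (1, u) := by
  change (if (1 : ℝ) ≤ 2⁻¹ then R (2 * 1, u) else S (2 * 1 - 1, u)) = S (1, u)
  rw [if_neg (by norm_num)]; norm_num

/-- **Reversal of an annulus in time.** [folklore] -/
def revA (R : C(ℝ × 𝕊¹, M)) : C(ℝ × 𝕊¹, M) :=
  ⟨fun q => R (1 - q.1, q.2), R.continuous.comp ((continuous_const.sub continuous_fst).prodMk continuous_snd)⟩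

omit [ChartedSpace (𝔼 m) M] [IsManifold (𝓡 m) 1 M] in
/-- Values of the reversal. [folklore] -/
@[simp] theorem revA_apply (R : C(ℝ × 𝕊¹, M)) (t : ℝ) (u : 𝕊¹) : revA R (t, u) = R (1 - t, u) := rfl

/-- **Going along an annulus and back inserts the trivial class**: for `R` starting on `γ`,
`e(F, insert (R ⋆ R̄) X) = e(F, X)`. [folklore] -/
theorem eClass_insertDisc_concatA_revA (hm : 2 ≤ m) {γ : 𝕊¹ → M} (R : C(ℝ × 𝕊¹, M)) (hR0 : ∀ u, R (0, u) = γ u)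
    (X : C(𝔻², M)) (hX : ∀ u, X (bd u) = γ u) {F : 𝕊¹ → Fr m} (hF : IsStableFrameFieldOn γ F univ) :
    eClass (insertDisc (concatA R (revA R) fun u => by rw [revA_apply, sub_zero]) X fun u => by
        rw [concatA_one, revA_apply, sub_self, hR0, hX]) F
      (hF.congr_map fun u _ => by
        change insertDisc (concatA R (revA R) _) X _ (bd u) = γ u; rw [insertDisc_bd, concatA_zero, hR0]) =
    eClass X F (hF.congr_map fun u _ => hX u) := by
  -- the family `A_s`: along `R` up to time `s` and back
  set A : I → C(ℝ × 𝕊¹, M) := fun s => ⟨fun q => if q.1 ≤ 2⁻¹ then R ((s : ℝ) * (2 * q.1), q.2)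
      else R ((s : ℝ) * (2 - 2 * q.1), q.2), by
    refine Continuous.if_le ?_ ?_ continuous_fst continuous_const fun q hq => ?_
    · exact R.continuous.comp ((continuous_const.mul (continuous_const.mul continuous_fst)).prodMk continuous_snd)
    · exact R.continuous.comp ((continuous_const.mul (continuous_const.sub (continuous_const.mul continuous_fst))).prodMk
        continuous_snd)
    · rw [hq]; norm_num⟩ with hAdef
  have hAc : Continuous fun p : I × (ℝ × 𝕊¹) => A p.1 p.2 := by
    change Continuous fun p : I × (ℝ × 𝕊¹) => if p.2.1 ≤ 2⁻¹ then R ((p.1 : ℝ) * (2 * p.2.1), p.2.2)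
      else R ((p.1 : ℝ) * (2 - 2 * p.2.1), p.2.2)
    refine Continuous.if_le ?_ ?_ (continuous_fst.comp continuous_snd) continuous_const fun p hp => ?_
    · exact R.continuous.comp (((continuous_subtype_val.comp continuous_fst).mul
        (continuous_const.mul (continuous_fst.comp continuous_snd))).prodMk (continuous_snd.comp continuous_snd))
    · exact R.continuous.comp (((continuous_subtype_val.comp continuous_fst).mul
        (continuous_const.sub (continuous_const.mul (continuous_fst.comp continuous_snd)))).prodMk
          (continuous_snd.comp continuous_snd))
    · rw [hp]; norm_num
  have hA0 : ∀ (s : I) u, A s (0, u) = γ u := fun s u => by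
    change (if (0 : ℝ) ≤ 2⁻¹ then R ((s : ℝ) * (2 * 0), u) else R ((s : ℝ) * (2 - 2 * 0), u)) = γ u
    rw [if_pos (by norm_num)]; simp [hR0]
  have hA1 : ∀ (s : I) u, A s (1, u) = X (bd u) := fun s u => by
    change (if (1 : ℝ) ≤ 2⁻¹ then R ((s : ℝ) * (2 * 1), u) else R ((s : ℝ) * (2 - 2 * 1), u)) = X (bd u)
    rw [if_neg (by norm_num)]; simp [hR0, hX]
  have key := eClass_insertDisc_eq_of_family hm A hAc hA0 X hA1 hF
  -- ends: `s = 1` is `R ⋆ R̄`, `s = 0` is the constant annulus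
  have e1 : A 1 = concatA R (revA R) (fun u => by rw [revA_apply, sub_zero]) := by
    ext q
    change (if q.1 ≤ 2⁻¹ then R (((1 : I) : ℝ) * (2 * q.1), q.2) else R (((1 : I) : ℝ) * (2 - 2 * q.1), q.2)) =
      (if q.1 ≤ 2⁻¹ then R (2 * q.1, q.2) else R (1 - (2 * q.1 - 1), q.2))
    rw [show ((1 : I) : ℝ) = 1 from rfl, one_mul, one_mul]
    congr 2; ring_nf
  have hconst : ∀ t u, A 0 (t, u) = X (bd u) := fun t u => by
    change (if t ≤ 2⁻¹ then R (((0 : I) : ℝ) * (2 * t), u) else R (((0 : I) : ℝ) * (2 - 2 * t), u)) = X (bd u)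
    rw [show ((0 : I) : ℝ) = 0 from rfl, zero_mul, zero_mul, hR0, hX]; split_ifs <;> rfl
  have e0 : insertDisc (A 0) X (hA1 0) = X.comp ⟨halfRadial, continuous_halfRadial⟩ :=
    ContinuousMap.ext fun x => insertDisc_const_apply (A 0) X hconst x
  have hFX : IsStableFrameFieldOn (X ∘ bd) F univ := hF.congr_map fun u _ => hX u
  have h0 : eClass (insertDisc (A 0) X (hA1 0)) F (hF.congr_map fun u _ => by
      change insertDisc (A 0) X _ (bd u) = γ u; rw [insertDisc_bd, hA0]) = eClass X F hFX := by
    rw [eClass_congr_disc e0 _ (hFX.congr_map fun u _ => by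
      change X (halfRadial (bd u)) = X (bd u); rw [show halfRadial (bd u) = bd u from Subtype.ext (radial_bd (by norm_num) u)])]
    exact (framed_glue_iff hm _ X _ _).mp (framed_glue_halfRadial_left hm X)
  have e1' : insertDisc (concatA R (revA R) fun u => by rw [revA_apply, sub_zero]) X
      (fun u => by rw [concatA_one, revA_apply, sub_self, hR0, hX]) = insertDisc (A 1) X (hA1 1) := by
    have : ∀ (A₁ A₂ : C(ℝ × 𝕊¹, M)) (h₁ : ∀ u, A₁ (1, u) = X (bd u)) (h₂ : ∀ u, A₂ (1, u) = X (bd u)),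
        A₁ = A₂ → insertDisc A₁ X h₁ = insertDisc A₂ X h₂ := by
      intros A₁ A₂ h₁ h₂ e; subst e; rfl
    exact this _ _ _ _ e1.symm
  have hL : eClass (insertDisc (concatA R (revA R) fun u => by rw [revA_apply, sub_zero]) X fun u => by
        rw [concatA_one, revA_apply, sub_self, hR0, hX]) F
      (hF.congr_map fun u _ => by
        change insertDisc (concatA R (revA R) _) X _ (bd u) = γ u; rw [insertDisc_bd, concatA_zero, hR0]) =
      eClass (insertDisc (A 1) X (hA1 1)) F (hF.congr_map fun u _ => by
        change insertDisc (A 1) X _ (bd u) = γ u; rw [insertDisc_bd, hA0]) :=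
    eClass_congr_disc e1' _ _
  rw [hL, ← key]
  exact h0

/-! ### 3. Rewriting lemmas for the insertion formulas -/

section Formulas

omit [ChartedSpace (𝔼 m) M] [IsManifold (𝓡 m) 1 M]

/-- The radial map inside the radius. [folklore] -/
theorem radial_of_le {ρ : ℝ} {x : 𝔻²} (h : ‖(x : EuclideanSpace ℝ (Fin (1 + 1)))‖ ≤ ρ) :
    radial ρ x = ρ⁻¹ • (x : EuclideanSpace ℝ (Fin (1 + 1))) := by
  unfold radial; rw [if_pos h]

/-- The radial map outside the radius. [folklore] -/
theorem radial_of_lt {ρ : ℝ} {x : 𝔻²} (h : ρ < ‖(x : EuclideanSpace ℝ (Fin (1 + 1)))‖) :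
    radial ρ x = ‖(x : EuclideanSpace ℝ (Fin (1 + 1)))‖⁻¹ • (x : EuclideanSpace ℝ (Fin (1 + 1))) := by
  unfold radial; rw [if_neg (not_le.mpr h)]

/-- The doubling inside the half disc. [folklore] -/
theorem halfRadial_val_of_le {x : 𝔻²} (h : ‖(x : EuclideanSpace ℝ (Fin (1 + 1)))‖ ≤ 2⁻¹) :
    ((halfRadial x : 𝔻²) : EuclideanSpace ℝ (Fin (1 + 1))) = (2 : ℝ) • (x : EuclideanSpace ℝ (Fin (1 + 1))) := by
  change radial 2⁻¹ x = _; rw [radial_of_le h, inv_inv]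

/-- The doubling outside the half disc is the radial projection. [folklore] -/
theorem halfRadial_val_of_lt {x : 𝔻²} (h : 2⁻¹ < ‖(x : EuclideanSpace ℝ (Fin (1 + 1)))‖) :
    ((halfRadial x : 𝔻²) : EuclideanSpace ℝ (Fin (1 + 1))) =
      ‖(x : EuclideanSpace ℝ (Fin (1 + 1)))‖⁻¹ • (x : EuclideanSpace ℝ (Fin (1 + 1))) := by
  change radial 2⁻¹ x = _; rw [radial_of_lt h]

omit [TopologicalSpace M] in
/-- The insertion on the inner half disc. [folklore] -/
theorem insertFun_of_le {A : ℝ × 𝕊¹ → M} {X : 𝔻² → M} {x : 𝔻²} (h : ‖(x : EuclideanSpace ℝ (Fin (1 + 1)))‖ ≤ 2⁻¹) :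
    insertFun A X x = X (halfRadial x) := by
  unfold insertFun; rw [if_pos h]

omit [TopologicalSpace M] in
/-- The insertion on the outer annulus. [folklore] -/
theorem insertFun_of_lt {A : ℝ × 𝕊¹ → M} {X : 𝔻² → M} {x : 𝔻²} (h : 2⁻¹ < ‖(x : EuclideanSpace ℝ (Fin (1 + 1)))‖) :
    insertFun A X x = A (2 - 2 * ‖(x : EuclideanSpace ℝ (Fin (1 + 1)))‖, dir2 x) := by
  unfold insertFun; rw [if_neg (not_le.mpr h)]

/-- The concatenation at early times. [folklore] -/
theorem concatA_of_le {R S : C(ℝ × 𝕊¹, M)} {h : ∀ u, R (1, u) = S (0, u)} {t : ℝ} (ht : t ≤ 2⁻¹) (u : 𝕊¹) :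
    concatA R S h (t, u) = R (2 * t, u) := by
  change (if t ≤ 2⁻¹ then R (2 * t, u) else S (2 * t - 1, u)) = _; rw [if_pos ht]

/-- The concatenation at late times. [folklore] -/
theorem concatA_of_lt {R S : C(ℝ × 𝕊¹, M)} {h : ∀ u, R (1, u) = S (0, u)} {t : ℝ} (ht : 2⁻¹ < t) (u : 𝕊¹) :
    concatA R S h (t, u) = S (2 * t - 1, u) := by
  change (if t ≤ 2⁻¹ then R (2 * t, u) else S (2 * t - 1, u)) = _; rw [if_neg (not_le.mpr ht)]

/-- **Positive multiples have the same direction.** [folklore] -/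
theorem dir2_eq_of_smul {x y : 𝔻²} {c : ℝ} (hc : 0 < c)
    (h : (y : EuclideanSpace ℝ (Fin (1 + 1))) = c • (x : EuclideanSpace ℝ (Fin (1 + 1))))
    (hx : (x : EuclideanSpace ℝ (Fin (1 + 1))) ≠ 0) : dir2 y = dir2 x := by
  have hy : (y : EuclideanSpace ℝ (Fin (1 + 1))) ≠ 0 := by
    rw [h]; exact smul_ne_zero hc.ne' hx
  apply Subtype.ext
  rw [dir2_val hy, dir2_val hx, h, norm_smul, Real.norm_of_nonneg hc.le, mul_inv, smul_smul, mul_comm c⁻¹,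
    mul_assoc, inv_mul_cancel₀ hc.ne', mul_one]

/-- The boundary point in the direction of `x` is the unit multiple of `x`. [folklore] -/
theorem bd_dir2_val {x : 𝔻²} (hx : (x : EuclideanSpace ℝ (Fin (1 + 1))) ≠ 0) :
    ((bd (dir2 x) : 𝔻²) : EuclideanSpace ℝ (Fin (1 + 1))) =
      ‖(x : EuclideanSpace ℝ (Fin (1 + 1)))‖⁻¹ • (x : EuclideanSpace ℝ (Fin (1 + 1))) := by
  change ((dir2 x : 𝕊¹) : EuclideanSpace ℝ (Fin (1 + 1))) = _; exact dir2_val hx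

end Formulas

/-! ### 4. Three-layer discs and the iterated insertion -/

section Layer

/-- **The three-layer disc**: `R` on the annulus `a ≤ ‖x‖ ≤ 1` (time `(1 - ‖x‖)/(1 - a)`), `S` on
`b ≤ ‖x‖ ≤ a` (time `(a - ‖x‖)/(a - b)`), `W` at speed `1/b` inside. [folklore] -/
def layer3Fun (a b : ℝ) (hb : 0 < b) (R S : ℝ × 𝕊¹ → M) (W : 𝔻² → M) (x : 𝔻²) : M :=
  if a ≤ ‖(x : EuclideanSpace ℝ (Fin (1 + 1)))‖ then R ((1 - ‖(x : EuclideanSpace ℝ (Fin (1 + 1)))‖) / (1 - a), dir2 x)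
  else if b ≤ ‖(x : EuclideanSpace ℝ (Fin (1 + 1)))‖ then S ((a - ‖(x : EuclideanSpace ℝ (Fin (1 + 1)))‖) / (a - b), dir2 x)
  else W (radialD b hb x)

omit [ChartedSpace (𝔼 m) M] [IsManifold (𝓡 m) 1 M] in
/-- **Joint continuity of three-layer discs** for continuous radii `1 > a_z > b_z > 0`. [folklore] -/
theorem continuous_layer3Fun {Z : Type*} [TopologicalSpace Z] {a b : Z → ℝ} (hac : Continuous a) (hbc : Continuous b)
    (ha1 : ∀ z, a z < 1) (hba : ∀ z, b z < a z) (hb0 : ∀ z, 0 < b z)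
    {R S : Z → ℝ × 𝕊¹ → M} {W : Z → 𝔻² → M}
    (hR : Continuous fun p : Z × (ℝ × 𝕊¹) => R p.1 p.2) (hS : Continuous fun p : Z × (ℝ × 𝕊¹) => S p.1 p.2)
    (hW : Continuous fun p : Z × 𝔻² => W p.1 p.2)
    (hRS : ∀ z u, R z (1, u) = S z (0, u)) (hSW : ∀ z u, S z (1, u) = W z (bd u)) :
    Continuous fun p : Z × 𝔻² => layer3Fun (a p.1) (b p.1) (hb0 p.1) (R p.1) (S p.1) (W p.1) p.2 := by
  have hval : Continuous fun p : Z × 𝔻² => ((p.2 : 𝔻²) : EuclideanSpace ℝ (Fin (1 + 1))) :=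
    continuous_subtype_val.comp continuous_snd
  have hnorm : Continuous fun p : Z × 𝔻² => ‖((p.2 : 𝔻²) : EuclideanSpace ℝ (Fin (1 + 1)))‖ := hval.norm
  have ha' : Continuous fun p : Z × 𝔻² => a p.1 := hac.comp continuous_fst
  have hb' : Continuous fun p : Z × 𝔻² => b p.1 := hbc.comp continuous_fst
  have hne : ∀ p : Z × 𝔻², b p.1 ≤ ‖((p.2 : 𝔻²) : EuclideanSpace ℝ (Fin (1 + 1)))‖ →
      ((p.2 : 𝔻²) : EuclideanSpace ℝ (Fin (1 + 1))) ≠ 0 := fun p hp h0 => by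
    rw [h0, norm_zero] at hp; exact absurd hp (not_le.mpr (hb0 p.1))
  have hdirb : ContinuousOn (fun p : Z × 𝔻² => dir2 p.2) {p | b p.1 ≤ ‖((p.2 : 𝔻²) : EuclideanSpace ℝ (Fin (1 + 1)))‖} :=
    continuousOn_dir2.comp continuous_snd.continuousOn fun p hp => hne p hp
  have hdira : ContinuousOn (fun p : Z × 𝔻² => dir2 p.2) {p | a p.1 ≤ ‖((p.2 : 𝔻²) : EuclideanSpace ℝ (Fin (1 + 1)))‖} :=
    hdirb.mono fun p hp => (hba p.1).le.trans hp
  -- the inner two layers, globally continuous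
  have hinner : Continuous fun p : Z × 𝔻² => if b p.1 ≤ ‖((p.2 : 𝔻²) : EuclideanSpace ℝ (Fin (1 + 1)))‖
      then S p.1 ((a p.1 - ‖((p.2 : 𝔻²) : EuclideanSpace ℝ (Fin (1 + 1)))‖) / (a p.1 - b p.1), dir2 p.2)
      else W p.1 (radialD (b p.1) (hb0 p.1) p.2) := by
    refine continuous_if_le hb' hnorm ?_ ?_ fun p hp => ?_
    · exact hS.comp_continuousOn (continuousOn_fst.prodMk ((((ha'.sub hnorm).div (ha'.sub hb')
        fun p => (sub_pos.mpr (hba p.1)).ne')).continuousOn.prodMk hdirb))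
    · have hr := continuous_radial (Z := Z) (ρ := b) hbc hb0
      exact (hW.comp (continuous_fst.prodMk (hr.subtype_mk _))).continuousOn
    · have hp' : ‖((p.2 : 𝔻²) : EuclideanSpace ℝ (Fin (1 + 1)))‖ = b p.1 := hp.symm
      have hx : ((p.2 : 𝔻²) : EuclideanSpace ℝ (Fin (1 + 1))) ≠ 0 := hne p hp.le
      rw [hp', div_self (sub_pos.mpr (hba p.1)).ne', hSW]
      congr 1
      apply Subtype.ext
      rw [bd_dir2_val hx]
      change _ = radial (b p.1) p.2
      rw [radial_of_le hp.ge, hp']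
  unfold layer3Fun
  refine continuous_if_le ha' hnorm ?_ hinner.continuousOn fun p hp => ?_
  · exact hR.comp_continuousOn (continuousOn_fst.prodMk ((((continuous_const.sub hnorm).div (continuous_const.sub ha')
      fun p => (sub_pos.mpr (ha1 p.1)).ne')).continuousOn.prodMk hdira))
  · have hp' : ‖((p.2 : 𝔻²) : EuclideanSpace ℝ (Fin (1 + 1)))‖ = a p.1 := hp.symm
    rw [hp', div_self (sub_pos.mpr (ha1 p.1)).ne', hRS, if_pos (hp ▸ (hba p.1).le), sub_self, zero_div]

omit [TopologicalSpace M] [ChartedSpace (𝔼 m) M] [IsManifold (𝓡 m) 1 M] in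
/-- The boundary of a three-layer disc is `R(0, ·)` (`a < 1`). [folklore] -/
theorem layer3Fun_bd {a b : ℝ} (ha : a ≤ 1) (hb : 0 < b) (R S : ℝ × 𝕊¹ → M) (W : 𝔻² → M) (u : 𝕊¹) :
    layer3Fun a b hb R S W (bd u) = R (0, u) := by
  have hu : ‖((bd u : 𝔻²) : EuclideanSpace ℝ (Fin (1 + 1)))‖ = 1 := norm_eq_of_mem_sphere u
  unfold layer3Fun
  rw [if_pos (by rw [hu]; exact ha), hu, sub_self, zero_div, dir2_bd]

/-- **The three-layer disc with radii `(3/4, 1/2)` is the insertion of the concatenation.**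
[folklore] -/
theorem layer3Fun_eq_insertFun_concatA (R S : C(ℝ × 𝕊¹, M)) (h : ∀ u, R (1, u) = S (0, u)) (W : 𝔻² → M)
    (hSW : ∀ u, S (1, u) = W (bd u)) (x : 𝔻²) :
    layer3Fun (3 / 4) 2⁻¹ inv_two_pos' R S W x = insertFun (concatA R S h) W x := by
  set r := ‖(x : EuclideanSpace ℝ (Fin (1 + 1)))‖ with hr
  unfold layer3Fun
  by_cases h34 : (3 : ℝ) / 4 ≤ r
  · rw [if_pos h34, insertFun_of_lt (by linarith), concatA_of_le (by linarith)]
    congr 2; rw [← hr]; ring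
  · rw [if_neg h34]
    push Not at h34
    by_cases h12 : (2 : ℝ)⁻¹ < r
    · rw [if_pos h12.le, insertFun_of_lt h12, concatA_of_lt (by linarith)]
      congr 2; rw [← hr]; norm_num; ring
    · push Not at h12
      rw [insertFun_of_le h12]
      by_cases heq : (2 : ℝ)⁻¹ ≤ r
      · -- the middle circle `‖x‖ = 1/2`
        have hr12 : r = 2⁻¹ := le_antisymm h12 heq
        have hx : (x : EuclideanSpace ℝ (Fin (1 + 1))) ≠ 0 := by
          intro h0; rw [hr, h0, norm_zero] at hr12; norm_num at hr12
        rw [if_pos heq, ← hr, hr12, show ((3 : ℝ) / 4 - 2⁻¹) / (3 / 4 - 2⁻¹) = 1 by norm_num, hSW]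
        congr 1
        apply Subtype.ext
        rw [bd_dir2_val hx, halfRadial_val_of_le h12, ← hr, hr12, inv_inv]
      · rw [if_neg heq]; rfl

/-- **The three-layer disc with radii `(1/2, 1/4)` is the iterated insertion.** [folklore] -/
theorem layer3Fun_eq_insertFun_insertFun (R S : C(ℝ × 𝕊¹, M)) (h : ∀ u, R (1, u) = S (0, u)) (W : 𝔻² → M)
    (hSW : ∀ u, S (1, u) = W (bd u)) (x : 𝔻²) :
    layer3Fun 2⁻¹ 4⁻¹ (by norm_num) R S W x = insertFun R (insertFun S W) x := by
  set r := ‖(x : EuclideanSpace ℝ (Fin (1 + 1)))‖ with hr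
  unfold layer3Fun
  by_cases h12 : (2 : ℝ)⁻¹ < r
  · rw [if_pos h12.le, insertFun_of_lt h12]
    congr 2; rw [← hr]; norm_num; ring
  · push Not at h12
    have hx0 : r ≤ 2⁻¹ := h12
    rw [insertFun_of_le hx0]
    -- the doubled point
    have hy : ((halfRadial x : 𝔻²) : EuclideanSpace ℝ (Fin (1 + 1))) = (2 : ℝ) • (x : EuclideanSpace ℝ (Fin (1 + 1))) :=
      halfRadial_val_of_le hx0
    have hny : ‖((halfRadial x : 𝔻²) : EuclideanSpace ℝ (Fin (1 + 1)))‖ = 2 * r := by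
      rw [hy, norm_smul, Real.norm_of_nonneg (by norm_num : (0 : ℝ) ≤ 2), hr]
    by_cases heq : (2 : ℝ)⁻¹ ≤ r
    · -- `‖x‖ = 1/2`: `R(1, ·) = S(0, ·)`
      have hr12 : r = 2⁻¹ := le_antisymm hx0 heq
      have hx : (x : EuclideanSpace ℝ (Fin (1 + 1))) ≠ 0 := by
        intro h0; rw [hr, h0, norm_zero] at hr12; norm_num at hr12
      rw [if_pos heq, ← hr, hr12, show (1 - (2 : ℝ)⁻¹) / (1 - 2⁻¹) = 1 by norm_num, h]
      rw [insertFun_of_lt (by rw [hny, hr12]; norm_num), hny, hr12, show (2 : ℝ) - 2 * (2 * 2⁻¹) = 0 by norm_num,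
        dir2_eq_of_smul (by norm_num : (0 : ℝ) < 2) hy hx]
    · rw [if_neg heq]
      push Not at heq
      have hx14 : r < 2⁻¹ := heq
      by_cases h14 : (4 : ℝ)⁻¹ < r
      · -- the `S`-layer
        have hx : (x : EuclideanSpace ℝ (Fin (1 + 1))) ≠ 0 := by
          intro h0; rw [hr, h0, norm_zero] at h14; norm_num at h14
        rw [if_pos h14.le, insertFun_of_lt (by rw [hny]; linarith), hny, dir2_eq_of_smul (by norm_num : (0 : ℝ) < 2) hy hx]
        congr 2; rw [← hr]; norm_num; ring
      · push Not at h14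
        rw [insertFun_of_le (by rw [hny]; linarith)]
        by_cases heq4 : (4 : ℝ)⁻¹ ≤ r
        · -- `‖x‖ = 1/4`: `S(1, ·) = W ∘ bd`
          have hr14 : r = 4⁻¹ := le_antisymm h14 heq4
          have hx : (x : EuclideanSpace ℝ (Fin (1 + 1))) ≠ 0 := by
            intro h0; rw [hr, h0, norm_zero] at hr14; norm_num at hr14
          rw [if_pos heq4, ← hr, hr14, show ((2 : ℝ)⁻¹ - 4⁻¹) / (2⁻¹ - 4⁻¹) = 1 by norm_num, hSW]
          congr 1
          apply Subtype.ext
          rw [bd_dir2_val hx, halfRadial_val_of_le (by rw [hny]; linarith), hy, smul_smul, ← hr, hr14]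
          norm_num
        · rw [if_neg heq4]
          congr 1
          apply Subtype.ext
          change radial 4⁻¹ x = ((halfRadial (halfRadial x) : 𝔻²) : EuclideanSpace ℝ (Fin (1 + 1)))
          push Not at heq4
          rw [radial_of_le heq4.le, halfRadial_val_of_le (by rw [hny]; linarith), hy, smul_smul]
          norm_num

/-- **Iterated insertion is insertion of the concatenation, in classes**: for annuli `R` (from `α`
to `β`) and `S` (from `β` to `δ`) and a disc `W` bounding `δ`,
`e(Fα, insert (R ⋆ S) W) = e(Fα, insert R (insert S W))`. [folklore] -/
theorem eClass_insertDisc_concatA (hm : 2 ≤ m) {α : 𝕊¹ → M} (R S : C(ℝ × 𝕊¹, M)) (hR0 : ∀ u, R (0, u) = α u)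
    (h : ∀ u, R (1, u) = S (0, u)) (W : C(𝔻², M)) (hSW : ∀ u, S (1, u) = W (bd u))
    {F : 𝕊¹ → Fr m} (hF : IsStableFrameFieldOn α F univ) :
    eClass (insertDisc (concatA R S h) W fun u => (concatA_one R S h u).trans (hSW u)) F
        (hF.congr_map fun u _ => by change insertDisc (concatA R S h) W _ (bd u) = α u; rw [insertDisc_bd, concatA_zero, hR0]) =
      eClass (insertDisc R (insertDisc S W hSW) fun u => (h u).trans (insertDisc_bd S W hSW u).symm) F
        (hF.congr_map fun u _ => by change insertDisc R _ _ (bd u) = α u; rw [insertDisc_bd, hR0]) := by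
  -- the family of three-layer discs with radii `(3/4 - s/4, 1/2 - s/4)`
  set a : I → ℝ := fun s => 3 / 4 - (s : ℝ) / 4 with ha
  set b : I → ℝ := fun s => 2⁻¹ - (s : ℝ) / 4 with hb
  have hb0 : ∀ s, 0 < b s := fun s => by rw [hb]; dsimp only; linarith [s.2.2]
  have hba : ∀ s, b s < a s := fun s => by rw [ha, hb]; dsimp only; norm_num
  have ha1 : ∀ s, a s < 1 := fun s => by rw [ha]; dsimp only; linarith [s.2.1]
  have hYc : Continuous fun p : I × 𝔻² => layer3Fun (a p.1) (b p.1) (hb0 p.1) R S W p.2 :=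
    continuous_layer3Fun (Z := I) (R := fun _ => R) (S := fun _ => S) (W := fun _ => W) (by rw [ha]; fun_prop) (by rw [hb]; fun_prop)
      ha1 hba hb0 (R.continuous.comp continuous_snd) (S.continuous.comp continuous_snd) (W.continuous.comp continuous_snd)
      (fun _ u => h u) fun _ u => hSW u
  set Y : I → C(𝔻², M) := fun s => ⟨fun x => layer3Fun (a s) (b s) (hb0 s) R S W x,
    hYc.comp (continuous_const.prodMk continuous_id)⟩ with hY
  have hYbd : ∀ (s : I) u, Y s (bd u) = α u := fun s u => by
    change layer3Fun (a s) (b s) (hb0 s) R S W (bd u) = α u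
    rw [layer3Fun_bd (ha1 s).le, hR0]
  have hFY : ∀ s : I, IsStableFrameFieldOn (Y s ∘ bd) F univ := fun s => hF.congr_map fun u _ => hYbd s u
  have hsame : eClass (Y 0) F (hFY 0) = eClass (Y 1) F (hFY 1) := by
    have hfr := (framed_glue_iff_of_family (m := m) (D₁ := fun _ => Y 0) (D₂ := fun s => Y s)
      ((Y 0).continuous.comp continuous_snd) hYc fun s u => (hYbd 0 u).trans (hYbd s u).symm).mp
      (framed_glue_self hm (Y 0))
    exact (framed_glue_iff hm (Y 0) (Y 1) _ (hFY 0)).mp hfr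
  -- the ends
  have e0 : Y 0 = insertDisc (concatA R S h) W fun u => (concatA_one R S h u).trans (hSW u) := by
    ext x
    change layer3Fun (a 0) (b 0) (hb0 0) R S W x = insertFun (concatA R S h) W x
    have : ∀ (a' b' : ℝ) (hb' : 0 < b') (ea : a' = 3 / 4) (eb : b' = 2⁻¹),
        layer3Fun a' b' hb' R S W x = insertFun (concatA R S h) W x := by
      intros a' b' hb' ea eb; subst ea eb; exact layer3Fun_eq_insertFun_concatA R S h W hSW x
    exact this _ _ _ (by rw [ha]; dsimp only; norm_num) (by rw [hb]; dsimp only; norm_num)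
  have e1 : Y 1 = insertDisc R (insertDisc S W hSW) fun u => (h u).trans (insertDisc_bd S W hSW u).symm := by
    ext x
    change layer3Fun (a 1) (b 1) (hb0 1) R S W x = insertFun R (insertFun S W) x
    have : ∀ (a' b' : ℝ) (hb' : 0 < b') (ea : a' = 2⁻¹) (eb : b' = 4⁻¹),
        layer3Fun a' b' hb' R S W x = insertFun R (insertFun S W) x := by
      intros a' b' hb' ea eb; subst ea eb; exact layer3Fun_eq_insertFun_insertFun R S h W hSW x
    exact this _ _ _ (by rw [ha]; dsimp only; norm_num) (by rw [hb]; dsimp only; norm_num)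
  rw [← eClass_congr_disc e0 (hFY 0), ← eClass_congr_disc e1 (hFY 1)]
  exact hsame

end Layer

/-! ### 5. Going along an annulus and back -/

section Back

/-- **Inserting an annulus and then its reversal does not change the class**:
`e(F, insert R (insert R̄ X)) = e(F, X)` for a disc `X` bounding the initial circle of `R`.
[folklore] -/
theorem eClass_insertDisc_insertDisc_revA (hm : 2 ≤ m) {α : 𝕊¹ → M} (R : C(ℝ × 𝕊¹, M)) (hR0 : ∀ u, R (0, u) = α u)
    (X : C(𝔻², M)) (hX : ∀ u, X (bd u) = α u) {F : 𝕊¹ → Fr m} (hF : IsStableFrameFieldOn α F univ) :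
    eClass (insertDisc R (insertDisc (revA R) X fun u => by rw [revA_apply, sub_self, hR0, hX])
        fun u => by rw [insertDisc_bd, revA_apply, sub_zero]) F
      (hF.congr_map fun u _ => by change insertDisc R _ _ (bd u) = α u; rw [insertDisc_bd, hR0]) =
    eClass X F (hF.congr_map fun u _ => hX u) := by
  have h1 := eClass_insertDisc_concatA hm R (revA R) hR0 (fun u => by rw [revA_apply, sub_zero]) X
    (fun u => by rw [revA_apply, sub_self, hR0, hX]) hF
  have h2 := eClass_insertDisc_concatA_revA hm R hR0 X hX hF
  exact h1.symm.trans h2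

/-- **The classes transported along an annulus and along its reversal agree**: with
`c(R) = e(Fα, insert R W) + e(Fβ, W)` (independent of `W`, `eClass_insertDisc_add_eClass_path`) one
has `c(R̄) = c(R)`; stated on discs: for `X` bounding `α` and `W` bounding `β`,
`e(Fα, insert R W) + e(Fβ, W) = e(Fβ, insert R̄ X) + e(Fα, X)`. [folklore] -/
theorem eClass_insertDisc_revA_add (hm : 2 ≤ m) {α β : 𝕊¹ → M} (R : C(ℝ × 𝕊¹, M)) (hR0 : ∀ u, R (0, u) = α u)
    (hR1 : ∀ u, R (1, u) = β u) (X W : C(𝔻², M)) (hX : ∀ u, X (bd u) = α u) (hW : ∀ u, W (bd u) = β u)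
    {Fα Fβ : 𝕊¹ → Fr m} (hFα : IsStableFrameFieldOn α Fα univ) (hFβ : IsStableFrameFieldOn β Fβ univ) :
    eClass (insertDisc R W fun u => (hR1 u).trans (hW u).symm) Fα
        (hFα.congr_map fun u _ => by change insertDisc R W _ (bd u) = α u; rw [insertDisc_bd, hR0]) +
      eClass W Fβ (hFβ.congr_map fun u _ => hW u) =
    eClass (insertDisc (revA R) X fun u => by rw [revA_apply, sub_self, hR0, hX]) Fβ
        (hFβ.congr_map fun u _ => by change insertDisc (revA R) X _ (bd u) = β u; rw [insertDisc_bd, revA_apply, sub_zero, hR1]) +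
      eClass X Fα (hFα.congr_map fun u _ => hX u) := by
  -- compare through the disc `W₀ = insert R̄ X` bounding `β`
  have hadd := eClass_insertDisc_add_eClass_path hm R hR0 hR1 W (insertDisc (revA R) X fun u => by
    rw [revA_apply, sub_self, hR0, hX]) hW (fun u => by rw [insertDisc_bd, revA_apply, sub_zero, hR1]) hFα hFβ
  have hback := eClass_insertDisc_insertDisc_revA hm R hR0 X hX hFα
  rw [hadd]
  have : ∀ a b d : ZMod 2, a = d → a + b = b + d := by decide
  exact this _ _ _ hback

end Back

end StableFrames

end Literature.Topology.FourManifolds
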